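/-
Copyright (c) 2026 the pub-hodgecm-mathlib formalisation cell (harness21).  Prover seat hodgecm-mathlib-R90-C133-p02 (g0), Track B ∕ R90-TF, h413 = `stmt-HodgeConjecture-24833`,
R90-TF section S8 «ContSpec-n½» (deal S8-R104 (d) of R90-CS-plan (g2), 2026-09-04T23:08Z; road of record = K2E1-p12's `R90/S8/CENSUS-SiegelTopCorr.K2E1-p12-g4.md` c6e608f03d316e7e):
letter (d) of ★ p862884 — the SIEGEL-TOP CORRECTION of the middle residue (`𝟙[T < w₁]·ψ(γ₀ỹ·ỹ)`, profile `ψ = ρ·(M(3∕2)φ)·H^{1∕2}` UNBOUNDED above the floor) is ORTHOGONAL TO EVERY CUSP FORM —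
★ FILE A with the `L¹` letter obtained by the `L²` ROUTE (one-coset equality + AM–GM on the quotient + the Siegel tail law ★ `K2E1SiegelTailMemL2CMThree`).
-/
import Summits.HodgeConjecture.HodgeConjecture.Theorems.K2E1SphericalEisensteinResidueOrthogonalCMThree   -- ★ (K2E4-p10) THE TEMPLATE (top pole, bounded profile) + its ★ inputs: FILE A `integral_quotFun_eisensteinSeriesU_mul_conj_eq_zero_three`, FILE B, the cusp dictionary, `siegel_three`, …
import Summits.HodgeConjecture.HodgeConjecture.Theorems.K2E1SiegelTailMemL2CMThree                         -- ★ (this seat, T-hr2-3): `lintegral_ite_lt_supHeight_rpow_lt_top_cm_three` (the Siegel tail law on the quotient)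
import Summits.HodgeConjecture.HodgeConjecture.Theorems.K2E1CuspFormsMeanZeroSoftU                          -- ★ `borelHeight_rightRelOut_mul`
import HarnessLib

/-!
# S8 #2∕#3 road (G side), letter (d) — `R90S8SiegelTopCorrectionCuspOrthogonalU3`: THE SIEGEL-TOP CORRECTION OF THE MIDDLE RESIDUE IS ORTHOGONAL TO CUSP FORMS
# (`U(2,1)_{L∕L⁺}`; profile `ψ` left-`B(F)`-`N(𝔸)`-invariant with `‖ψ‖ ≤ K·H^a`, `a < 1` — UNBOUNDED above the floor, so the `L¹` letter comes from the `L²` route)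

Track B ∕ R90-TF, crux h413 = `stmt-HodgeConjecture-24833`, route of record `HCCMUnconditional`; cell `hodgecm-mathlib`, R90-TF section S8 «ContSpec-n½ ∕ ResidualSpectrum», sub-socket (R)
of B ED. 5 via ★ p862884 `R90S8ResGMidAtomOrthogonalCuspidalU3` (K2E1-p12), whose letter (d) is `hcorr : ∀ φ, ⟪cuspFormsToLp μ 𝔓 φ, corr⟫ = 0` for the Siegel-top correction `corr` of the
middle residue — in K2E1-p16's ★ bytes (`K2E1ChiContinuedEisensteinMiddleResidueCMThree.quotFun_residue_ae_eq_add_tail`): `corr x = 𝟙[T < w₁ x]·ρψ(γ₀(ỹ)·ỹ)·H(γ₀(ỹ)·ỹ)^{2−z₀}`, `ỹ = x̃⁻¹`,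
`γ₀` a maximiser selector.  THEOREMS ONLY (no `def`, no `instance`, no `notation`, no named-fact hypothesis, no `sorry`; default heartbeats); lane `--supports stmt-HodgeConjecture-24833
--as helper` (count-neutral).  CLOSES NO SOCKET: pays letter (d) for every profile `ψ` with `‖ψ g‖ ≤ K·H(g)^a`, `a < 1` (middle pole: `ψ g = ρψ g·H(g)^{2−z₀}`, `a = Re(2 − z₀) = ½`,
`K = ‖ρψ‖_∞` — the bound on `ρψ` is the consumer's visible letter).

THE MATHEMATICS ([MoeglinWaldspurger1995, I.2.13, II.1.8, IV.1.11]; [BernsteinLapid2019, §4 Claim 2]; road of record: K2E1-p12's CENSUS-SiegelTopCorr).  As in the ★ TEMPLATE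
`inner_cuspFormsToLp_eq_zero_of_ae_eq_siegelIndicator_cm_three` (top pole, `ψ ≡ κ` bounded): above the floor `T ≥ 1` the cut-off profile `f_T = 𝟙_{H>T}·ψ` has AT MOST ONE live `B(F)`-coset
(★ `subsingleton_setOf_lt_borelHeight_out_mul`, Siegel property ★ `siegel_three`), namely the maximiser's, so `E(f_T)(ỹ) = 𝟙[T < w₁(x)]·ψ(γ₀ỹ·ỹ) = corr(x)` (§1, the ONE-COSET EQUALITY at the
maximiser — the general-`ψ` twin of ★ `quotFun_eisensteinSeriesU_indicator_one`), and ★ FILE A «`E(f) ⊥ Λ` when `Λ_B ≡ 0`» gives `⟪φ̂, corr⟫ = 0` once the `L¹` LETTER `∫⁻ β·‖f_T·conj Λ‖ₑ < ∞` holds.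
At the middle pole `ψ` is UNBOUNDED on `{H > T}` (`∝ H^{1∕2}`), so the template's one-term bound (★ `tsum_enorm_indicator_lt_le`, needs `‖ψ‖ ≤ M`) fails; instead (★ FILE B
`lintegral_weight_enorm_mul_lt_top_of_lintegral_quotient_lt_top`) the letter reduces to `∫⁻_X (Σ'_q ‖f_T(q̃ỹ)‖ₑ)·‖φ(x)‖ₑ dμ < ∞`, where by §1 the coset sum IS `𝟙[T < w₁]·‖ψ(γ₀ỹ·ỹ)‖ₑ
≤ G := 𝟙[T < w₁]·K·w₁^a` (`H(γ₀ỹ·ỹ) = w₁(x)`), and `G·‖φ‖ₑ ≤ G² + ‖φ‖ₑ²` with `∫ G² = K²·∫ 𝟙[T<w₁]·w₁^{2a} < ∞` — the Siegel tail law on the quotient ★ `lintegral_ite_lt_supHeight_rpow_lt_top_cm_three`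
(`2a < 2`) — and `∫ ‖φ‖ₑ² < ∞` (`φ ∈ L²`).
* §1 `tsum_indicator_rightRelOut_mul_eq_of_isMax` (ONE-COSET EQUALITY, every rank, any `AddCommMonoid` value: `Σ'_q (𝟙_{H>T}Φ)(q̃·y) = 𝟙[T < H(γ₀y)]·Φ(γ₀y)` at a maximiser `γ₀`);
  AM–GM `x·y ≤ x² + y²` in `ℝ≥0∞` is ★ `Literature.Analysis.FluidPDE.ennreal_mul_le_sq_add_sq` — re-proved INLINE (a `have`, no declaration) to avoid importing the Navier–Stokes estate here.
* §2 **`inner_cuspFormsToLp_eq_zero_of_ae_eq_siegelTail_cm_three`** — THE HEAD: `⟪cuspFormsToLp μ 𝔓 φ, v⟫ = 0` for every continuous square-integrable cusp form `φ` and every `v ∈ L²(μ)` with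
  `v =ᵐ x ↦ 𝟙[T < w₁ x]·ψ(γ₀(ỹ)·ỹ)` (`ψ` measurable, left-`B(F)`- and `N(𝔸)`-invariant, `‖ψ g‖ ≤ K·H(g)^a`, `a < 1`; `γ₀` ANY maximiser selector; `T ≥ 1`).
HONEST LABEL: HC_CM is proved only modulo the 7 printed citations (2 remaining named inputs: hLiu418 = `stmt-HodgeConjecture-24832`, h413 = `stmt-HodgeConjecture-24833`) until
rung 0 closes; REL ≠ ★ ≠ BUILT; letter-free over ★ (the profile's invariance ∕ growth are the visible data); asserts no named fact and closes no socket; count-neutral.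

## References
* [MoeglinWaldspurger1995] C. Mœglin, J.-L. Waldspurger, *Spectral Decomposition and Eisenstein Series* (1995), I.2.13, II.1.8, IV.1.11.
* [BernsteinLapid2019] J. Bernstein, E. Lapid, *On the meromorphic continuation of Eisenstein series*, J. AMS (2019), §4 Claim 2.
* [Garrett2018] P. Garrett, *Modern Analysis of Automorphic Forms by Example* (2018), §2.10 (one live coset above the floor).
-/

set_option autoImplicit false
set_option linter.dupNamespace false  -- the mandated namespace `…HodgeConjecture.HodgeConjecture.R90.S8` (LEAD #1 L1) repeats the summit's segment

noncomputable section

open MeasureTheory Measure NumberField IsDedekindDomain Set Filter Topology MulAction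
open scoped ENNReal NNReal InnerProductSpace ComplexConjugate
open Literature.MeasureTheory.Group Literature.NumberTheory
open Literature.NumberTheory.Automorphic Literature.NumberTheory.Automorphic.UnitaryGroup AdelicGroupData
open Summit.HodgeConjecture.HodgeConjecture.Cruxes.H413.K2E1BorelEisensteinU
open Summit.HodgeConjecture.HodgeConjecture.Cruxes.H413.K2E1BorelCosetsDictionary (eisensteinSeriesU_eq_tsum_arithmeticBorelQuot)
open Summit.HodgeConjecture.HodgeConjecture.Cruxes.H413.K2E1TruncatedEisensteinExplicit
open Summit.HodgeConjecture.HodgeConjecture.Cruxes.H413.K2E1BLEisensteinCuspOrthogonalU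
open Summit.HodgeConjecture.HodgeConjecture.Cruxes.H413.K2E1BLEisensteinInWeightedSpaceU2 (lintegral_weight_enorm_mul_lt_top_of_lintegral_quotient_lt_top exists_isCoveringWeight_arithmeticBorel)
open Summit.HodgeConjecture.HodgeConjecture.Cruxes.H413.K2E1CuspConditionDictionaryU (invQuot_package_of_mem_cuspForms)
open Summit.HodgeConjecture.HodgeConjecture.Cruxes.H413.K2E1BLBorelSpacesU2Defs
open Summit.HodgeConjecture.HodgeConjecture.Cruxes.H413.K2E1BLEisensteinInWeightedSpaceU2Weights (supHeight_eq_ciSup_arithmetic)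
open Summit.HodgeConjecture.HodgeConjecture.Cruxes.H413.K2E1BLHeckeOperatorWeightedU2 (bddAbove_range_borelHeight_arith_mul)
open Summit.HodgeConjecture.HodgeConjecture.Cruxes.H413.K2E1SphericalEisensteinResidueOrthogonalU
open Summit.HodgeConjecture.HodgeConjecture.Cruxes.H413.K2E1TruncatedEisensteinCuspOrthogonalCMThree
open Summit.HodgeConjecture.HodgeConjecture.Cruxes.H413.K2E1CuspFormsMeanZeroSoftU (borelHeight_rightRelOut_mul)
open Summit.HodgeConjecture.HodgeConjecture.Cruxes.H413.K2E1SiegelTailMemL2CMThree (lintegral_ite_lt_supHeight_rpow_lt_top_cm_three)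

namespace Summit.HodgeConjecture.HodgeConjecture.R90.S8

/-! ## §1 The one-coset equality at a maximiser (every rank) -/

section OneCoset

variable {F E : Type} [Field F] [NumberField F] [Field E] [NumberField E] [Algebra F E] {c : E ≃ₐ[F] E} {N : ℕ} [NeZero N]

/-- **ONE-COSET EQUALITY AT A MAXIMISER** (every rank; the general-profile twin of ★ `quotFun_eisensteinSeriesU_indicator_one`): under the Siegel property and `T ≥ 1`, for a left-`B(F)`-invariant
`Φ` (any topological additive monoid of values) and `γ₀` maximising `γ ↦ H(γ·y)`: `Σ'_{q ∈ B(F)∖G(F)} (𝟙_{H>T}Φ)(q̃·y) = 𝟙[T < H(γ₀·y)]·Φ(γ₀·y)` — at most one live coset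
(★ `subsingleton_setOf_lt_borelHeight_out_mul`), which is the maximiser's when there is one. [cite: Garrett2018, §2.10] [cite: MoeglinWaldspurger1995, I.2.13] -/
theorem tsum_indicator_rightRelOut_mul_eq_of_isMax {M : Type*} [AddCommMonoid M] [TopologicalSpace M]
    (hSiegel : ∀ γ : (quasiSplit F E c N).arithmeticSubgroup, γ ∉ arithmeticBorel F E c N →
      ∀ g : (quasiSplit F E c N).Adelic, borelHeight ((γ : (quasiSplit F E c N).Adelic) * g) * borelHeight g ≤ 1)
    {T : ℝ≥0} (hT : 1 ≤ T) {Φ : (quasiSplit F E c N).Adelic → M}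
    (hΦ : ∀ b ∈ arithmeticBorel F E c N, ∀ x : (quasiSplit F E c N).Adelic, Φ ((b : (quasiSplit F E c N).Adelic) * x) = Φ x)
    (y : (quasiSplit F E c N).Adelic) (γ₀ : (quasiSplit F E c N).arithmeticSubgroup)
    (hγ₀ : ∀ γ : (quasiSplit F E c N).arithmeticSubgroup, borelHeight ((γ : (quasiSplit F E c N).Adelic) * y) ≤ borelHeight ((γ₀ : (quasiSplit F E c N).Adelic) * y)) :
    ∑' q : Quotient (QuotientGroup.rightRel (arithmeticBorel F E c N)),
        {g : (quasiSplit F E c N).Adelic | T < borelHeight g}.indicator Φ (((q.out : (quasiSplit F E c N).arithmeticSubgroup) : (quasiSplit F E c N).Adelic) * y) =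
      if T < borelHeight ((γ₀ : (quasiSplit F E c N).Adelic) * y) then Φ ((γ₀ : (quasiSplit F E c N).Adelic) * y) else 0 := by
  have hsub := subsingleton_setOf_lt_borelHeight_out_mul hSiegel hT y
  -- the representative of the maximiser's coset: `q₀.out = b'·γ₀`, `b' ∈ B(F)`
  set q₀ : Quotient (QuotientGroup.rightRel (arithmeticBorel F E c N)) := Quotient.mk (QuotientGroup.rightRel (arithmeticBorel F E c N)) γ₀ with hq₀
  have hb' : q₀.out * γ₀⁻¹ ∈ arithmeticBorel F E c N := by
    have h := inv_mem (QuotientGroup.rightRel_apply.1 (Quotient.mk_out (s := QuotientGroup.rightRel (arithmeticBorel F E c N)) γ₀))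
    rwa [mul_inv_rev, inv_inv] at h
  have hout : ((q₀.out : (quasiSplit F E c N).arithmeticSubgroup) : (quasiSplit F E c N).Adelic) * y =
      (((q₀.out * γ₀⁻¹ : (quasiSplit F E c N).arithmeticSubgroup)) : (quasiSplit F E c N).Adelic) * (((γ₀ : (quasiSplit F E c N).Adelic)) * y) := by
    rw [← mul_assoc, ← Subgroup.coe_mul, inv_mul_cancel_right]
  have hH0 : borelHeight (((q₀.out : (quasiSplit F E c N).arithmeticSubgroup) : (quasiSplit F E c N).Adelic) * y) = borelHeight ((γ₀ : (quasiSplit F E c N).Adelic) * y) :=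
    borelHeight_rightRelOut_mul γ₀ y
  by_cases hlive : T < borelHeight ((γ₀ : (quasiSplit F E c N).Adelic) * y)
  · -- exactly one live coset, `q₀`
    rw [if_pos hlive]
    have hq₀mem : q₀ ∈ {q : Quotient (QuotientGroup.rightRel (arithmeticBorel F E c N)) |
        T < borelHeight (((q.out : (quasiSplit F E c N).arithmeticSubgroup) : (quasiSplit F E c N).Adelic) * y)} := by
      show T < _
      rw [hH0]
      exact hlive
    rw [tsum_eq_single q₀ fun q hq => Set.indicator_of_notMem (s := {g : (quasiSplit F E c N).Adelic | T < borelHeight g}) (fun hq' => hq (hsub hq' hq₀mem)) _,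
      Set.indicator_of_mem (s := {g : (quasiSplit F E c N).Adelic | T < borelHeight g}) hq₀mem, hout, hΦ _ hb']
  · -- no live coset: every term vanishes
    rw [if_neg hlive]
    refine (tsum_congr fun q => ?_).trans tsum_zero
    refine Set.indicator_of_notMem (s := {g : (quasiSplit F E c N).Adelic | T < borelHeight g}) (fun hq => hlive ?_) _
    exact lt_of_lt_of_le hq (hγ₀ _)

end OneCoset

/-! ## §2 The head at `U(2,1)_{L∕L⁺}`: the Siegel-top correction of the middle residue is orthogonal to every cusp form -/

section Head

variable (L : Type) [Field L] [NumberField L] [IsCMField L]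
  [MeasurableSpace (quasiSplit (↥(maximalRealSubfield L)) L (IsCMField.complexConj L) 3).Adelic] [BorelSpace (quasiSplit (↥(maximalRealSubfield L)) L (IsCMField.complexConj L) 3).Adelic]
  (μ : Measure (quasiSplit (↥(maximalRealSubfield L)) L (IsCMField.complexConj L) 3).automorphicQuotient)
  [(quasiSplit (↥(maximalRealSubfield L)) L (IsCMField.complexConj L) 3).IsAutomorphicMeasure μ]

/-- **LETTER (d): `⟪φ̂, corr⟫ = 0` — THE SIEGEL-TOP CORRECTION OF THE MIDDLE RESIDUE IS ORTHOGONAL TO EVERY CUSP FORM.**  Data: a Haar measure `ν` on `N(𝔸)` with a relatively compact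
fundamental domain `𝓕` of `N(F)`, the parabolic datum `(𝔓, i)` with `𝔓.radical i = N(𝔸)`, the floor `T ≥ 1`; a measurable profile `ψ`, left-`B(F)`- and left-`N(𝔸)`-invariant, with the
growth `‖ψ g‖ ≤ K·H(g)^a`, `a < 1` (middle pole: `ψ = ρψ·H^{2−z₀}`, `a = ½`); ANY maximiser selector `γ₀` (`H(δ·y) ≤ H(γ₀(y)·y)`); and `v ∈ L²(μ)` with
`v =ᵐ x ↦ 𝟙[T < w₁ x]·ψ(γ₀(ỹ)·ỹ)` (`ỹ = x̃⁻¹`; = K2E1-p16's `tail` bytes at `ψ g := ρψ g·H(g)^{2−z₀}`).  THEN `⟪cuspFormsToLp μ 𝔓 φ, v⟫ = 0` for every continuous square-integrable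
cusp form `φ`.  Proof = ★ TEMPLATE with the `L¹` letter by the `L²` route (§1 one-coset equality, AM–GM, ★ Siegel tail law on the quotient, `φ ∈ L²`).
[cite: MoeglinWaldspurger1995, I.2.13, II.1.8, IV.1.11] [cite: BernsteinLapid2019, §4 Claim 2] -/
theorem inner_cuspFormsToLp_eq_zero_of_ae_eq_siegelTail_cm_three
    (ν : Measure ↥(adelicUnipotent (↥(maximalRealSubfield L)) L (IsCMField.complexConj L) 3)) [ν.IsHaarMeasure]
    {𝓕 : Set ↥(adelicUnipotent (↥(maximalRealSubfield L)) L (IsCMField.complexConj L) 3)}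
    (h𝓕N : IsFundamentalDomain ↥(rationalUnipotent (↥(maximalRealSubfield L)) L (IsCMField.complexConj L) 3) 𝓕 ν) (h𝓕c : IsCompact (closure 𝓕))
    (𝔓 : (quasiSplit (↥(maximalRealSubfield L)) L (IsCMField.complexConj L) 3).ParabolicUnipotentData) (i : 𝔓.ι)
    (h𝔓 : 𝔓.radical i = adelicUnipotent (↥(maximalRealSubfield L)) L (IsCMField.complexConj L) 3) {T : ℝ≥0} (hT : 1 ≤ T)
    {ψ : (quasiSplit (↥(maximalRealSubfield L)) L (IsCMField.complexConj L) 3).Adelic → ℂ} (hψm : Measurable ψ)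
    (hψB : ∀ b ∈ arithmeticBorel (↥(maximalRealSubfield L)) L (IsCMField.complexConj L) 3, ∀ x : (quasiSplit (↥(maximalRealSubfield L)) L (IsCMField.complexConj L) 3).Adelic,
      ψ ((b : (quasiSplit (↥(maximalRealSubfield L)) L (IsCMField.complexConj L) 3).Adelic) * x) = ψ x)
    (hψN : ∀ (u : ↥(adelicUnipotent (↥(maximalRealSubfield L)) L (IsCMField.complexConj L) 3)) (g : (quasiSplit (↥(maximalRealSubfield L)) L (IsCMField.complexConj L) 3).Adelic),
      ψ ((u : (quasiSplit (↥(maximalRealSubfield L)) L (IsCMField.complexConj L) 3).Adelic) * g) = ψ g)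
    {K a : ℝ} (ha1 : a < 1)
    (hψK : ∀ g : (quasiSplit (↥(maximalRealSubfield L)) L (IsCMField.complexConj L) 3).Adelic, ‖ψ g‖ ≤ K * ((borelHeight g : ℝ≥0) : ℝ) ^ a)
    (γ₀ : (quasiSplit (↥(maximalRealSubfield L)) L (IsCMField.complexConj L) 3).Adelic → (quasiSplit (↥(maximalRealSubfield L)) L (IsCMField.complexConj L) 3).arithmeticSubgroup)
    (hγ₀ : ∀ (y : (quasiSplit (↥(maximalRealSubfield L)) L (IsCMField.complexConj L) 3).Adelic) (δ : (quasiSplit (↥(maximalRealSubfield L)) L (IsCMField.complexConj L) 3).arithmeticSubgroup),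
      borelHeight ((δ : (quasiSplit (↥(maximalRealSubfield L)) L (IsCMField.complexConj L) 3).Adelic) * y) ≤
        borelHeight ((γ₀ y : (quasiSplit (↥(maximalRealSubfield L)) L (IsCMField.complexConj L) 3).Adelic) * y))
    (v : (quasiSplit (↥(maximalRealSubfield L)) L (IsCMField.complexConj L) 3).L2 μ)
    (hv : (v : (quasiSplit (↥(maximalRealSubfield L)) L (IsCMField.complexConj L) 3).automorphicQuotient → ℂ) =ᵐ[μ] fun x =>
      if T < supHeight (↥(maximalRealSubfield L)) L (IsCMField.complexConj L) 3 x then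
        ψ ((γ₀ (Quotient.out (x : (quasiSplit (↥(maximalRealSubfield L)) L (IsCMField.complexConj L) 3).Adelic ⧸
              (quasiSplit (↥(maximalRealSubfield L)) L (IsCMField.complexConj L) 3).quotientSubgroup))⁻¹ : (quasiSplit (↥(maximalRealSubfield L)) L (IsCMField.complexConj L) 3).Adelic) *
            (Quotient.out (x : (quasiSplit (↥(maximalRealSubfield L)) L (IsCMField.complexConj L) 3).Adelic ⧸
              (quasiSplit (↥(maximalRealSubfield L)) L (IsCMField.complexConj L) 3).quotientSubgroup))⁻¹)
      else 0)
    (φ : ↥((quasiSplit (↥(maximalRealSubfield L)) L (IsCMField.complexConj L) 3).cuspForms μ 𝔓)) :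
    ⟪(quasiSplit (↥(maximalRealSubfield L)) L (IsCMField.complexConj L) 3).cuspFormsToLp μ 𝔓 φ, v⟫_ℂ = 0 := by
  haveI := t2Space_adeleRing_of_numberField L
  haveI := locallyCompactSpace_adeleRing' L
  haveI := secondCountableTopology_adeleRing L
  haveI : T2Space (quasiSplit (↥(maximalRealSubfield L)) L (IsCMField.complexConj L) 3).Adelic :=
    inferInstanceAs (T2Space (adelic (↥(maximalRealSubfield L)) L (IsCMField.complexConj L) 3 ((StdForm.antidiagonal 3).over L)))
  haveI : LocallyCompactSpace (quasiSplit (↥(maximalRealSubfield L)) L (IsCMField.complexConj L) 3).Adelic :=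
    inferInstanceAs (LocallyCompactSpace (adelic (↥(maximalRealSubfield L)) L (IsCMField.complexConj L) 3 ((StdForm.antidiagonal 3).over L)))
  haveI : SecondCountableTopology (quasiSplit (↥(maximalRealSubfield L)) L (IsCMField.complexConj L) 3).Adelic :=
    inferInstanceAs (SecondCountableTopology (adelic (↥(maximalRealSubfield L)) L (IsCMField.complexConj L) 3 ((StdForm.antidiagonal 3).over L)))
  have hc : (IsCMField.complexConj L) * (IsCMField.complexConj L) = 1 := AlgEquiv.ext fun x => IsCMField.complexConj_apply_apply L x
  have hc1 : (IsCMField.complexConj L) ≠ 1 := IsCMField.complexConj_ne_one L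
  haveI : (haar : Measure (quasiSplit (↥(maximalRealSubfield L)) L (IsCMField.complexConj L) 3).Adelic).IsMulRightInvariant :=
    forall_isHaarMeasure_isMulRightInvariant_quasiSplit_cm L (by norm_num : 2 ≤ 3) haar inferInstance
  haveI : (haar : Measure (quasiSplit (↥(maximalRealSubfield L)) L (IsCMField.complexConj L) 3).Adelic).IsInvInvariant := isInvInvariant_of_isMulRightInvariant _
  haveI : ν.IsInvInvariant := Summit.HodgeConjecture.HodgeConjecture.Cruxes.H413.K2E1HeisenbergHaarU3.isInvInvariant_of_isHaarMeasure_adelicUnipotent_three hc ν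
  have h𝓕₀ : ν 𝓕 ≠ 0 := measure_ne_zero_of_isFundamentalDomain_rationalUnipotent ν h𝓕N
  have h𝓕top : ν 𝓕 ≠ ∞ := ((measure_mono subset_closure).trans_lt h𝓕c.measure_lt_top).ne
  obtain ⟨β, hβ⟩ := exists_isCoveringWeight_arithmeticBorel (F := (↥(maximalRealSubfield L))) (E := L) (c := (IsCMField.complexConj L)) (N := 3)
  -- the cut-off profile `f_T = 𝟙_{H>T}·ψ`
  set fT : (quasiSplit (↥(maximalRealSubfield L)) L (IsCMField.complexConj L) 3).Adelic → ℂ :=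
    {g : (quasiSplit (↥(maximalRealSubfield L)) L (IsCMField.complexConj L) 3).Adelic | T < borelHeight g}.indicator ψ with hfT
  have hsm : MeasurableSet {g : (quasiSplit (↥(maximalRealSubfield L)) L (IsCMField.complexConj L) 3).Adelic | T < borelHeight g} :=
    measurableSet_lt measurable_const continuous_borelHeight.measurable
  have hfm : Measurable fT := hψm.indicator hsm
  have hfB := forall_arithmeticBorel_indicator hψB fun h => T < h
  have hfN : ∀ (u : ↥(adelicUnipotent (↥(maximalRealSubfield L)) L (IsCMField.complexConj L) 3)) (g : (quasiSplit (↥(maximalRealSubfield L)) L (IsCMField.complexConj L) 3).Adelic),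
      fT ((u : (quasiSplit (↥(maximalRealSubfield L)) L (IsCMField.complexConj L) 3).Adelic) * g) = fT g := fun u g => by
    simp only [hfT, Set.indicator_apply, Set.mem_setOf_eq, borelHeight_unipotent_mul u.2, hψN u g]
  -- the cusp form lifted to `G(𝔸)`
  obtain ⟨hΛm, hΛinv, hΛq, hΛB⟩ := invQuot_package_of_mem_cuspForms 𝔓 i h𝔓 ν h𝓕N φ.2
  have hΛG : ∀ (γ : (quasiSplit (↥(maximalRealSubfield L)) L (IsCMField.complexConj L) 3).arithmeticSubgroup) (x : (quasiSplit (↥(maximalRealSubfield L)) L (IsCMField.complexConj L) 3).Adelic),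
      invQuot (quasiSplit (↥(maximalRealSubfield L)) L (IsCMField.complexConj L) 3) (φ : (quasiSplit (↥(maximalRealSubfield L)) L (IsCMField.complexConj L) 3).automorphicQuotient → ℂ)
        ((γ : (quasiSplit (↥(maximalRealSubfield L)) L (IsCMField.complexConj L) 3).Adelic) * x) =
      invQuot (quasiSplit (↥(maximalRealSubfield L)) L (IsCMField.complexConj L) 3) (φ : (quasiSplit (↥(maximalRealSubfield L)) L (IsCMField.complexConj L) 3).automorphicQuotient → ℂ) x :=
    fun γ x => hΛinv _ ((quasiSplit (↥(maximalRealSubfield L)) L (IsCMField.complexConj L) 3).arithmeticSubgroup_le_quotientSubgroup γ.2) x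
  have hq : ∀ x : (quasiSplit (↥(maximalRealSubfield L)) L (IsCMField.complexConj L) 3).automorphicQuotient,
      invQuot (quasiSplit (↥(maximalRealSubfield L)) L (IsCMField.complexConj L) 3) (φ : (quasiSplit (↥(maximalRealSubfield L)) L (IsCMField.complexConj L) 3).automorphicQuotient → ℂ)
        (Quotient.out (x : (quasiSplit (↥(maximalRealSubfield L)) L (IsCMField.complexConj L) 3).Adelic ⧸ (quasiSplit (↥(maximalRealSubfield L)) L (IsCMField.complexConj L) 3).quotientSubgroup))⁻¹ =
      (φ : (quasiSplit (↥(maximalRealSubfield L)) L (IsCMField.complexConj L) 3).automorphicQuotient → ℂ) x := fun x => congrFun hΛq x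
  have hφ2 : MemLp (φ : (quasiSplit (↥(maximalRealSubfield L)) L (IsCMField.complexConj L) 3).automorphicQuotient → ℂ) 2 μ := AdelicGroupData.memLp_of_mem_cuspForms φ.2
  -- the maximiser at `ỹ = x̃⁻¹` realises `w₁`
  have hW : ∀ x : (quasiSplit (↥(maximalRealSubfield L)) L (IsCMField.complexConj L) 3).automorphicQuotient,
      borelHeight ((γ₀ (Quotient.out (x : (quasiSplit (↥(maximalRealSubfield L)) L (IsCMField.complexConj L) 3).Adelic ⧸
          (quasiSplit (↥(maximalRealSubfield L)) L (IsCMField.complexConj L) 3).quotientSubgroup))⁻¹ : (quasiSplit (↥(maximalRealSubfield L)) L (IsCMField.complexConj L) 3).Adelic) *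
        (Quotient.out (x : (quasiSplit (↥(maximalRealSubfield L)) L (IsCMField.complexConj L) 3).Adelic ⧸ (quasiSplit (↥(maximalRealSubfield L)) L (IsCMField.complexConj L) 3).quotientSubgroup))⁻¹) =
      supHeight (↥(maximalRealSubfield L)) L (IsCMField.complexConj L) 3 x := by
    intro x
    rw [supHeight_eq_ciSup_arithmetic]
    exact le_antisymm (le_ciSup (bddAbove_range_borelHeight_arith_mul _) (γ₀ _)) (ciSup_le (hγ₀ _))
  -- §1 at the maximiser: the coset sum of `‖f_T‖ₑ` IS `𝟙[T < w₁]·‖ψ(γ₀ỹ·ỹ)‖ₑ`, and the coset sum of `f_T` IS the tail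
  have hsumE : ∀ x : (quasiSplit (↥(maximalRealSubfield L)) L (IsCMField.complexConj L) 3).automorphicQuotient,
      (∑' q : Quotient (QuotientGroup.rightRel (arithmeticBorel (↥(maximalRealSubfield L)) L (IsCMField.complexConj L) 3)),
        ‖fT (((q.out : (quasiSplit (↥(maximalRealSubfield L)) L (IsCMField.complexConj L) 3).arithmeticSubgroup) : (quasiSplit (↥(maximalRealSubfield L)) L (IsCMField.complexConj L) 3).Adelic) *
          (Quotient.out x : (quasiSplit (↥(maximalRealSubfield L)) L (IsCMField.complexConj L) 3).Adelic)⁻¹)‖ₑ) =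
      if T < supHeight (↥(maximalRealSubfield L)) L (IsCMField.complexConj L) 3 x then
        ‖ψ ((γ₀ (Quotient.out (x : (quasiSplit (↥(maximalRealSubfield L)) L (IsCMField.complexConj L) 3).Adelic ⧸
              (quasiSplit (↥(maximalRealSubfield L)) L (IsCMField.complexConj L) 3).quotientSubgroup))⁻¹ : (quasiSplit (↥(maximalRealSubfield L)) L (IsCMField.complexConj L) 3).Adelic) *
            (Quotient.out (x : (quasiSplit (↥(maximalRealSubfield L)) L (IsCMField.complexConj L) 3).Adelic ⧸
              (quasiSplit (↥(maximalRealSubfield L)) L (IsCMField.complexConj L) 3).quotientSubgroup))⁻¹)‖ₑ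
      else 0 := by
    intro x
    have hψE : ∀ b ∈ arithmeticBorel (↥(maximalRealSubfield L)) L (IsCMField.complexConj L) 3, ∀ z : (quasiSplit (↥(maximalRealSubfield L)) L (IsCMField.complexConj L) 3).Adelic,
        ‖ψ ((b : (quasiSplit (↥(maximalRealSubfield L)) L (IsCMField.complexConj L) 3).Adelic) * z)‖ₑ = ‖ψ z‖ₑ := fun b hb z => by
      rw [hψB b hb z]
    have h := tsum_indicator_rightRelOut_mul_eq_of_isMax (Φ := fun g => ‖ψ g‖ₑ) siegel_three hT hψE
      (Quotient.out (x : (quasiSplit (↥(maximalRealSubfield L)) L (IsCMField.complexConj L) 3).Adelic ⧸ (quasiSplit (↥(maximalRealSubfield L)) L (IsCMField.complexConj L) 3).quotientSubgroup))⁻¹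
      (γ₀ _) (hγ₀ _)
    rw [hW x] at h
    rw [← h]
    refine tsum_congr fun q => ?_
    simp only [hfT, enorm_indicator_eq_indicator_enorm]
  have hsum : ∀ x : (quasiSplit (↥(maximalRealSubfield L)) L (IsCMField.complexConj L) 3).automorphicQuotient,
      (quasiSplit (↥(maximalRealSubfield L)) L (IsCMField.complexConj L) 3).quotFun (eisensteinSeriesU fT) x =
      if T < supHeight (↥(maximalRealSubfield L)) L (IsCMField.complexConj L) 3 x then
        ψ ((γ₀ (Quotient.out (x : (quasiSplit (↥(maximalRealSubfield L)) L (IsCMField.complexConj L) 3).Adelic ⧸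
              (quasiSplit (↥(maximalRealSubfield L)) L (IsCMField.complexConj L) 3).quotientSubgroup))⁻¹ : (quasiSplit (↥(maximalRealSubfield L)) L (IsCMField.complexConj L) 3).Adelic) *
            (Quotient.out (x : (quasiSplit (↥(maximalRealSubfield L)) L (IsCMField.complexConj L) 3).Adelic ⧸
              (quasiSplit (↥(maximalRealSubfield L)) L (IsCMField.complexConj L) 3).quotientSubgroup))⁻¹)
      else 0 := by
    intro x
    change eisensteinSeriesU fT (Quotient.out (x : (quasiSplit (↥(maximalRealSubfield L)) L (IsCMField.complexConj L) 3).Adelic ⧸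
      (quasiSplit (↥(maximalRealSubfield L)) L (IsCMField.complexConj L) 3).quotientSubgroup))⁻¹ = _
    rw [eisensteinSeriesU_eq_tsum_arithmeticBorelQuot hfB, ← hW x]
    exact tsum_indicator_rightRelOut_mul_eq_of_isMax siegel_three hT hψB _ (γ₀ _) (hγ₀ _)
  -- THE `L¹` LETTER by the `L²` route (AM–GM inline: `x·y ≤ x² + y²` in `ℝ≥0∞`)
  have hamgm : ∀ x y : ℝ≥0∞, x * y ≤ x ^ 2 + y ^ 2 := fun x y => by
    rcases le_total x y with h | h
    · calc x * y ≤ y * y := mul_le_mul' h le_rfl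
        _ = y ^ 2 := (sq y).symm
        _ ≤ x ^ 2 + y ^ 2 := le_add_self
    · calc x * y ≤ x * x := mul_le_mul' le_rfl h
        _ = x ^ 2 := (sq x).symm
        _ ≤ x ^ 2 + y ^ 2 := le_self_add
  have hτ : 2 * a < 2 := by linarith
  have htail := lintegral_ite_lt_supHeight_rpow_lt_top_cm_three L μ haar hτ (lt_of_lt_of_le zero_lt_one hT)
  have hφint : Integrable (fun x => ‖(φ : (quasiSplit (↥(maximalRealSubfield L)) L (IsCMField.complexConj L) 3).automorphicQuotient → ℂ) x‖ ^ 2) μ :=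
    (memLp_two_iff_integrable_sq_norm hφ2.1).1 hφ2
  have hL1 : ∫⁻ g, β g * ‖fT g * conj (invQuot (quasiSplit (↥(maximalRealSubfield L)) L (IsCMField.complexConj L) 3)
      (φ : (quasiSplit (↥(maximalRealSubfield L)) L (IsCMField.complexConj L) 3).automorphicQuotient → ℂ) g)‖ₑ ∂haar < ∞ := by
    refine lintegral_weight_enorm_mul_lt_top_of_lintegral_quotient_lt_top μ haar hβ hfm hΛm hfB hΛG ?_
    -- the majorant `G x = 𝟙[T < w₁ x]·ofReal (K·w₁^a)` and AM–GM
    set G : (quasiSplit (↥(maximalRealSubfield L)) L (IsCMField.complexConj L) 3).automorphicQuotient → ℝ≥0∞ := fun x =>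
      if T < supHeight (↥(maximalRealSubfield L)) L (IsCMField.complexConj L) 3 x then
        ENNReal.ofReal (K * ((supHeight (↥(maximalRealSubfield L)) L (IsCMField.complexConj L) 3 x : ℝ)) ^ a) else 0 with hG
    have hdom : ∀ x, (∑' q : Quotient (QuotientGroup.rightRel (arithmeticBorel (↥(maximalRealSubfield L)) L (IsCMField.complexConj L) 3)),
        ‖fT (((q.out : (quasiSplit (↥(maximalRealSubfield L)) L (IsCMField.complexConj L) 3).arithmeticSubgroup) : (quasiSplit (↥(maximalRealSubfield L)) L (IsCMField.complexConj L) 3).Adelic) *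
          (Quotient.out x : (quasiSplit (↥(maximalRealSubfield L)) L (IsCMField.complexConj L) 3).Adelic)⁻¹)‖ₑ) ≤ G x := by
      intro x
      rw [hsumE x]
      simp only [hG]
      split_ifs with hx
      · rw [← ofReal_norm]
        refine ENNReal.ofReal_le_ofReal ((hψK _).trans ?_)
        rw [hW x]
      · exact le_rfl
    have hG2 : ∫⁻ x, G x ^ 2 ∂μ < ∞ := by
      have hpt : ∀ x, G x ^ 2 ≤ ENNReal.ofReal (K ^ 2) *
          (if T < supHeight (↥(maximalRealSubfield L)) L (IsCMField.complexConj L) 3 x then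
            ENNReal.ofReal (((supHeight (↥(maximalRealSubfield L)) L (IsCMField.complexConj L) 3 x : ℝ)) ^ (2 * a)) else 0) := by
        intro x
        simp only [hG]
        split_ifs with hx
        · have hw0 : (0 : ℝ) ≤ ((supHeight (↥(maximalRealSubfield L)) L (IsCMField.complexConj L) 3 x : ℝ)) := NNReal.coe_nonneg _
          rw [← ENNReal.ofReal_pow (mul_nonneg ?_ (Real.rpow_nonneg hw0 _)), ← ENNReal.ofReal_mul (sq_nonneg K), mul_pow,
            ← Real.rpow_natCast (((supHeight (↥(maximalRealSubfield L)) L (IsCMField.complexConj L) 3 x : ℝ)) ^ a) 2, ← Real.rpow_mul hw0]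
          · push_cast
            rw [mul_comm a 2]
          · -- `0 ≤ K`: from `‖ψ g‖ ≤ K·H^a` at any point, with `H^a > 0`
            have h1 := hψK 1
            have hpos : (0 : ℝ) < ((borelHeight (1 : (quasiSplit (↥(maximalRealSubfield L)) L (IsCMField.complexConj L) 3).Adelic) : ℝ≥0) : ℝ) ^ a :=
              Real.rpow_pos_of_pos (by exact_mod_cast borelHeight_pos _) _
            nlinarith [norm_nonneg (ψ 1)]
        · simp
      refine lt_of_le_of_lt (lintegral_mono hpt) ?_
      rw [lintegral_const_mul' _ _ ENNReal.ofReal_ne_top]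
      exact ENNReal.mul_lt_top ENNReal.ofReal_lt_top htail
    have hφE : ∫⁻ x, ‖(φ : (quasiSplit (↥(maximalRealSubfield L)) L (IsCMField.complexConj L) 3).automorphicQuotient → ℂ) x‖ₑ ^ 2 ∂μ < ∞ := by
      have h := hφint.2
      rw [hasFiniteIntegral_iff_enorm] at h
      refine lt_of_le_of_lt (lintegral_mono fun x => le_of_eq ?_) h
      rw [← ofReal_norm, ← ENNReal.ofReal_pow (norm_nonneg _), Real.enorm_eq_ofReal (sq_nonneg _)]
    calc ∫⁻ x : (quasiSplit (↥(maximalRealSubfield L)) L (IsCMField.complexConj L) 3).automorphicQuotient,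
          (∑' q : Quotient (QuotientGroup.rightRel (arithmeticBorel (↥(maximalRealSubfield L)) L (IsCMField.complexConj L) 3)),
            ‖fT (((q.out : (quasiSplit (↥(maximalRealSubfield L)) L (IsCMField.complexConj L) 3).arithmeticSubgroup) : (quasiSplit (↥(maximalRealSubfield L)) L (IsCMField.complexConj L) 3).Adelic) *
              (Quotient.out x : (quasiSplit (↥(maximalRealSubfield L)) L (IsCMField.complexConj L) 3).Adelic)⁻¹)‖ₑ) *
            ‖invQuot (quasiSplit (↥(maximalRealSubfield L)) L (IsCMField.complexConj L) 3) (φ : (quasiSplit (↥(maximalRealSubfield L)) L (IsCMField.complexConj L) 3).automorphicQuotient → ℂ)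
              (Quotient.out x : (quasiSplit (↥(maximalRealSubfield L)) L (IsCMField.complexConj L) 3).Adelic)⁻¹‖ₑ ∂μ
        ≤ ∫⁻ x, (G x ^ 2 + ‖(φ : (quasiSplit (↥(maximalRealSubfield L)) L (IsCMField.complexConj L) 3).automorphicQuotient → ℂ) x‖ₑ ^ 2) ∂μ :=
          lintegral_mono fun x => by
            rw [hq x]
            exact (mul_le_mul' (hdom x) le_rfl).trans (hamgm _ _)
      _ < ∞ := by
          rw [lintegral_add_right' _ (hφ2.1.enorm.pow_const 2)]
          exact ENNReal.add_lt_top.2 ⟨hG2, hφE⟩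
  -- ★ FILE A, then identify `quotFun (E f_T)` with the tail
  have h0 := integral_quotFun_eisensteinSeriesU_mul_conj_eq_zero_three hc hc1 μ haar ν h𝓕N h𝓕₀ h𝓕top hβ hfm hΛm hfN hfB hΛG hL1 (ae_of_all _ hΛB)
  rw [hΛq] at h0
  rw [AdelicGroupData.cuspFormsToLp_apply, MeasureTheory.L2.inner_def]
  have hae : (fun x : (quasiSplit (↥(maximalRealSubfield L)) L (IsCMField.complexConj L) 3).automorphicQuotient =>
      ⟪(hφ2.toLp (φ : (quasiSplit (↥(maximalRealSubfield L)) L (IsCMField.complexConj L) 3).automorphicQuotient → ℂ)) x, v x⟫_ℂ) =ᵐ[μ]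
      fun x => (quasiSplit (↥(maximalRealSubfield L)) L (IsCMField.complexConj L) 3).quotFun (eisensteinSeriesU fT) x *
        conj ((φ : (quasiSplit (↥(maximalRealSubfield L)) L (IsCMField.complexConj L) 3).automorphicQuotient → ℂ) x) := by
    filter_upwards [hφ2.coeFn_toLp, hv] with x hx hvx
    rw [hx, hvx, RCLike.inner_apply, hsum x]
  rw [integral_congr_ae hae, h0]

end Head

end Summit.HodgeConjecture.HodgeConjecture.R90.S8

end
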